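import Summits.ResolutionOfSingularities.ResolutionOfSingularities.Theorems.PurelyInseparableDim4ParamCertTree
import Summits.ResolutionOfSingularities.ResolutionOfSingularities.Theorems.PurelyInseparableDim4ScopeBlindMonomialCoat
import HarnessLib

/-!
# [OURS · res-dim4-pi · F4-C-loc] PARAMETRIC CERTIFICATES, format v4 (part 2: SOUNDNESS): a checked v4 table certifies, for
  every row, every value `β ≠ 0` of the fibre letter and every bookkeeping, an A-win of the LOCAL in-scope game over
  every field of the characteristic

Cell `res-dim4-pi` (D-0157 DOOR 2, wave 2), seat `res-dim4-p-6` g3; sequel of `…ParamCertTree` (format v4).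

* §1 row-level glue: `pwin_of_memRow4B`, `rWins_step_zero4` (as v3), the pair check's `i ≠ i'`, and the COAT row:
  **`not_inCoordinateScope_of_pcoatB`** — a t-free row passing `pcoatB` is OUT of coordinate scope over every field
  (res-dim4-p-8 g3's `ScopeBlind.not_inCoordinateScope_monomialCoat_evalT` applied to the coefficient-mapped quotient).
* §2 **`pnode_sound`** (induction on the tree height `pheight`; `pnodeB_of_mem_forest`): every equimultiple reply in a
  certified chart leads to a won position or is impossible — `dead` by `coeff_ne_zero_of_pwitB`, `child`/`free`/`root`
  as in v3 (a `root` whose rational point is dead: `pwitB` on the translated chart), `pair` by `coord_eq_of_ppairB` +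
  `translate_pair_spec`, `rel` by `exists_zero_of_prelB`, `split` by `exists_zero_of_psplitB`, the subtrees taken at the
  vanishing letter.
* §3 **`pwin_of_pcert5B`** and the entry point **`rWins_liftState_of_pcert5B`** (checker v5 of `…ParamCertTree`: the
  pair node's letter point may be DEAD) (an `𝔽₃` state whose `embed` heads a
  checked v4 table is a local A-win over EVERY field of characteristic 3).

[OURS · counted 0 · certificate soundness; AI kernel work, weaker than expert review.]  NOTHING here is a statement about
resolution of singularities; resolution in dimension `≥ 4` / characteristic `p > 0` is NOT proved by anything in this
file.  bears_on: LADDER-RESOLUTION:D157-DOOR2 (res-dim4-pi · F4-C-loc all fields · parametric rows v4).  Host item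
(DR-157-C): `stmt-ResolutionOfSingularities-16155`, helper.
-/

set_option linter.dupNamespace false -- mandated namespace of this single-conjunct summit

noncomputable section

open MvPolynomial Finset
open scoped BigOperators

namespace Summit.ResolutionOfSingularities.ResolutionOfSingularities.Theorems.PIDim4

namespace LoopCLocal

open Literature.AlgebraicGeometry.Resolution
open Literature.AlgebraicGeometry.Resolution.Hauser2010
open Literature.AlgebraicGeometry.Resolution.CentreBlowup
open StepKit ParamLift

variable {k K : Type} [Field k] [Field K] [DecidableEq k] [DecidableEq K] (f : k →+* K)

/-! ## §1 Row-level glue -/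

/-- a later row presenting the same polynomial certifies it. OURS. [folklore] -/
theorem pwin_of_memRow4B {q : ℕ} {rest : List (PRow4 k)}
    (hrest : ∀ row ∈ rest, (∀ β : K, β ≠ 0 → ∀ (r : Fin 4 →₀ ℕ) (exc : Finset (Fin 4)),
      RWins q localB (⟨spec f β (evalT row.1), r, exc⟩ : State K))) {L : Terms 5 k}
    (h : memRow4B L rest = true) :
    (∀ β : K, β ≠ 0 → ∀ (r : Fin 4 →₀ ℕ) (exc : Finset (Fin 4)),
      RWins q localB (⟨spec f β (evalT L), r, exc⟩ : State K)) := by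
  obtain ⟨r, hr, hrc⟩ := List.any_eq_true.mp h
  intro β hβ rr exc
  rw [(evalT_eq_iff_equivB _ _).mpr hrc]
  exact hrest r hr β hβ rr exc

/-- **the origin child** (v4 rows). OURS. [folklore] -/
theorem rWins_step_zero4 {q : ℕ} {rest : List (PRow4 k)}
    (hrest : ∀ row ∈ rest, (∀ β : K, β ≠ 0 → ∀ (r : Fin 4 →₀ ℕ) (exc : Finset (Fin 4)),
      RWins q localB (⟨spec f β (evalT row.1), r, exc⟩ : State K))) {β : K} (hβ : β ≠ 0)
    {L G : Terms 5 k} {S : Finset (Fin 4)} {j : Fin 4} (hG : G = chartL q (S5 S) j.castSucc L)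
    (hchild : pchild4B (clean4 q G) rest = true) (r : Fin 4 →₀ ℕ) (exc : Finset (Fin 4))
    (hne : (CentreBlowup.step q S j (0 : Fin 4 → K) (⟨spec f β (evalT L), r, exc⟩ : State K)).F ≠ 0) :
    RWins q localB (CentreBlowup.step q S j (0 : Fin 4 → K) (⟨spec f β (evalT L), r, exc⟩ : State K)) := by
  set s' := CentreBlowup.step q S j (0 : Fin 4 → K) (⟨spec f β (evalT L), r, exc⟩ : State K) with hs'
  have hF : s'.F = spec f β (evalT (clean4 q G)) := by
    rw [hs', DivClock.step_F_eq, PointBlowup.translate_zero, chartTransform_spec, ← hG, deletePthPowers_spec]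
  unfold pchild4B at hchild
  rw [Bool.or_eq_true] at hchild
  rcases hchild with hzero | hmem
  · exfalso; apply hne
    rw [hF, (evalT_eq_zero_iff _).mpr hzero, map_zero]
  · have hw : RWins q localB (⟨spec f β (evalT (clean4 q G)), s'.r, s'.exc⟩ : State K) :=
      pwin_of_memRow4B f hrest hmem β hβ s'.r s'.exc
    rw [← hF] at hw
    exact hw

omit [Field K] [DecidableEq K] in
/-- the two letters of a pair check are distinct. OURS. [folklore] -/
theorem ppairB_ne {q : ℕ} {U : Finset (Fin 4)} {G : Terms 5 k} {γ : Fin 4 → ℕ} {i i' : Fin 4} {ρ : k} {d : ℕ}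
    (h : ppairB q U G γ i i' ρ d = true) : i ≠ i' := by
  unfold ppairB at h
  simp only [Bool.and_eq_true, Bool.not_eq_true', decide_eq_false_iff_not, decide_eq_true_eq] at h
  exact h.1.2

omit [DecidableEq K] in
/-- **a COAT row is out of coordinate scope over every field** (t-free row; monomial coat lifted along `f`).
OURS (wrapper of res-dim4-p-8 g3's lemma). [folklore] -/
theorem not_inCoordinateScope_of_pcoatB {q : ℕ} (hq : 2 ≤ q) {L : Terms 5 k} {m e₀ : Fin 4 → ℕ}
    {ex : Fin 4 → (Fin 4 → ℕ)} (h : pcoatB q L m e₀ ex = true) (β : K) :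
    ¬ InCoordinateScope q (spec f β (evalT L)) := by
  classical
  unfold pcoatB at h
  simp only [Bool.and_eq_true, Bool.not_eq_true', decide_eq_false_iff_not, decide_eq_true_eq] at h
  obtain ⟨⟨⟨⟨⟨htf, hdeg⟩, hdiv⟩, hne⟩, h0⟩, hX⟩ := h
  set T : Finset (Fin 4) := Finset.univ.filter fun i => m i ≠ 0 with hT
  have hfilt : (mapC f (divL m (trunc L))).filter (fun t => decide (∀ i ∈ T, t.1 i = 0)) =
      mapC f (coatRest m (trunc L)) := by
    unfold coatRest
    rw [← filter_mapC f (fun e => decide (∀ i : Fin 4, m i ≠ 0 → e i = 0))]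
    refine List.filter_congr fun t _ => ?_
    simp [hT]
  rw [spec_eq_map_trunc f β htf, evalT_eq_monomial_mul_divL hdiv, map_mul, map_monomial, map_one, ← evalT_mapC]
  refine ScopeBlind.not_inCoordinateScope_monomialCoat_evalT hq T (m := expo m) (fun i hi => ?_) ?_
    (mapC f (divL m (trunc L))) (e₀ := e₀) ?_ ?_ ?_
  · simpa [hT] using hi
  · rw [degree_expo]; exact hdeg
  · rw [hfilt, coeffAt_mapC]; exact (map_ne_zero_iff f f.injective).mpr hne
  · rw [hfilt, coeffAt_mapC, h0, map_zero]
  · intro i hi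
    have hmi : m i = 0 := by simpa [hT] using hi
    obtain ⟨hexi, hc⟩ := hX i hmi
    exact ⟨ex i, hexi, by rw [hfilt, coeffAt_mapC]; exact (map_ne_zero_iff f f.injective).mpr hc⟩

/-! ## §2 Soundness of the chart trees -/

section Tree

variable {q : ℕ} {rest : List (PRow4 k)} {β : K} {L : Terms 5 k} {S : Finset (Fin 4)} {j : Fin 4}
  (r : Fin 4 →₀ ℕ) (exc : Finset (Fin 4))

omit [DecidableEq k] [DecidableEq K] in
/-- the coefficient of a low exponent vanishes at an equimultiple point (chart data form). OURS. [folklore] -/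
theorem coeff_zero_of_equimultiple {b : Fin 4 → K} {γ : Fin 4 → ℕ} (h0 : γ ≠ 0) (hdeg : (∑ i, γ i) < q)
    (heq : IsEquimultiplePoint q S j b (⟨spec f β (evalT L), r, exc⟩ : State K)) :
    coeff (expo γ) (PointBlowup.translate b (spec f β (evalT (chartL q (S5 S) j.castSucc L)))) = 0 := by
  have hz := heq (expo γ) ((not_congr (expo_eq_zero_iff γ)).mpr h0) (by rw [degree_expo]; exact hdeg)
  rwa [pointTransform, chartTransform_spec] at hz

mutual
/-- the height of a chart tree (recursion depth of the soundness argument). OURS. [folklore] -/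
def pheight : PNode k → ℕ
  | .dead _ => 0
  | .child => 0
  | .free _ => 0
  | .root _ _ _ _ => 0
  | .pair _ _ _ _ _ sub => pheight sub + 1
  | .rel _ _ _ _ _ subs => pheightL subs + 1
  | .split _ subs => pheightL subs + 1
/-- the maximal height in a subtree list. OURS. [folklore] -/
def pheightL : List (Fin 4 × PNode k) → ℕ
  | [] => 0
  | (_, t) :: subs => max (pheight t) (pheightL subs)
end

omit [Field k] [DecidableEq k] in
/-- a member subtree is lower than the list's maximum. OURS. [folklore] -/
theorem pheight_le_of_mem : ∀ (subs : List (Fin 4 × PNode k)) (i : Fin 4) (t' : PNode k), (i, t') ∈ subs →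
    pheight t' ≤ pheightL subs
  | [], _, _, hm => absurd hm List.not_mem_nil
  | (i₀, t₀) :: subs, i, t', hm => by
    rw [pheightL]
    rcases List.mem_cons.mp hm with hh | ht
    · rw [(Prod.mk.inj hh).2]; exact le_max_left _ _
    · exact le_trans (pheight_le_of_mem subs i t' ht) (le_max_right _ _)

omit [Field K] [DecidableEq K] in
/-- the subtree filed under a letter passes the node check with that letter removed. OURS. [folklore] -/
theorem pnodeB_of_mem_forest {q : ℕ} {rest : List (PRow4 k)} {G : Terms 5 k} :
    ∀ (subs : List (Fin 4 × PNode k)) (U : Finset (Fin 4)), pforest5B q rest G U subs = true →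
      ∀ (i : Fin 4) (t' : PNode k), (i, t') ∈ subs → pnode5B q rest G (U.erase i) t' = true
  | [], _, _, _, _, hm => absurd hm List.not_mem_nil
  | (i₀, t₀) :: subs, U, h, i, t', hm => by
    simp only [pforest5B, Bool.and_eq_true] at h
    rcases List.mem_cons.mp hm with hh | ht
    · rw [(Prod.mk.inj hh).1, (Prod.mk.inj hh).2]; exact h.1
    · exact pnodeB_of_mem_forest subs U h.2 i t' ht

/-- **soundness of a chart tree** (by height): every equimultiple reply `b` vanishing off `U` in the chart `j` leads to
a won position (or is impossible). OURS. [folklore] -/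
theorem pnode_sound_aux
    (hrest : ∀ row ∈ rest, (∀ β : K, β ≠ 0 → ∀ (r : Fin 4 →₀ ℕ) (exc : Finset (Fin 4)),
      RWins q localB (⟨spec f β (evalT row.1), r, exc⟩ : State K))) (hβ : β ≠ 0) (n : ℕ) :
    ∀ (t : PNode k), pheight t < n → ∀ (U : Finset (Fin 4)),
      pnode5B q rest (chartL q (S5 S) j.castSucc L) U t = true →
      ∀ b : Fin 4 → K, (∀ m : Fin 4, m ∉ U → b m = 0) →
        IsEquimultiplePoint q S j b (⟨spec f β (evalT L), r, exc⟩ : State K) →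
        (CentreBlowup.step q S j b (⟨spec f β (evalT L), r, exc⟩ : State K)).F ≠ 0 →
        RWins q localB (CentreBlowup.step q S j b (⟨spec f β (evalT L), r, exc⟩ : State K)) := by
  induction n with
  | zero => intro t ht; exact absurd ht (Nat.not_lt_zero _)
  | succ n ih =>
  intro t ht U h b hb heq hne
  set G := chartL q (S5 S) j.castSucc L with hG
  cases t with
  | dead γ =>
    simp only [pnode5B] at h
    exact absurd (coeff_zero_of_equimultiple f r exc (pwitB_low h).1 (pwitB_low h).2 heq)
      (coeff_ne_zero_of_pwitB f β hβ h hb)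
  | child =>
    simp only [pnode5B, Bool.and_eq_true, decide_eq_true_eq] at h
    obtain ⟨hU, hchild⟩ := h
    subst hU
    have hb0 := eq_zero_of_vanish hb
    subst hb0
    exact rWins_step_zero4 f hrest hβ hG hchild r exc hne
  | free i =>
    simp only [pnode5B, Bool.and_eq_true, decide_eq_true_eq] at h
    obtain ⟨⟨⟨hU, htf⟩, hchild⟩, hmem⟩ := h
    subst hU
    by_cases hbi : b i = 0
    · have hb0 : b = 0 := by rw [eq_single_of_vanish hb, hbi, Pi.single_zero]
      subst hb0
      exact rWins_step_zero4 f hrest hβ hG hchild r exc hne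
    · set s' := CentreBlowup.step q S j b (⟨spec f β (evalT L), r, exc⟩ : State K) with hs'
      have hF : s'.F = spec f (b i) (evalT (clean4 q (shearL i G))) := by
        rw [hs', DivClock.step_F_eq, chartTransform_spec, ← hG, spec_eq_of_tfree f htf β (b i),
          eq_single_of_vanish hb, Pi.single_eq_same, translate_single_spec, shearAlg_evalT, deletePthPowers_spec]
      have hw : RWins q localB (⟨spec f (b i) (evalT (clean4 q (shearL i G))), s'.r, s'.exc⟩ : State K) :=
        pwin_of_memRow4B f hrest hmem (b i) hbi s'.r s'.exc
      rw [← hF] at hw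
      exact hw
  | root γ i ρ atRho =>
    simp only [pnode5B, Bool.and_eq_true, decide_eq_true_eq, Bool.or_eq_true] at h
    obtain ⟨⟨⟨hU, hroot⟩, hchild⟩, hat⟩ := h
    subst hU
    have hcases : b i = 0 ∨ b i = f ρ := by
      rcases hroot with hr | hr
      · exact coord_cases_of_prootB f β hr hb
          (coeff_zero_of_equimultiple f r exc (prootB_low hr).1 (prootB_low hr).2 heq)
      · refine coord_cases_of_prootB f β hr hb ?_
        rw [evalT_reverse]
        exact coeff_zero_of_equimultiple f r exc (prootB_low hr).1 (prootB_low hr).2 heq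
    rcases hcases with hbi | hbi
    · have hb0 : b = 0 := by rw [eq_single_of_vanish hb, hbi, Pi.single_zero]
      subst hb0
      exact rWins_step_zero4 f hrest hβ hG hchild r exc hne
    · have hbeq : b = Pi.single i (f ρ) := by rw [eq_single_of_vanish hb, hbi]
      cases atRho with
      | none =>
        set s' := CentreBlowup.step q S j b (⟨spec f β (evalT L), r, exc⟩ : State K) with hs'
        have hF : s'.F = spec f β (evalT (clean4 q (transVar i.castSucc ρ G))) := by
          rw [hs', DivClock.step_F_eq, chartTransform_spec, ← hG, hbeq, translate_single_map_spec, tau_evalT,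
            deletePthPowers_spec]
        have hw : RWins q localB
            (⟨spec f β (evalT (clean4 q (transVar i.castSucc ρ G))), s'.r, s'.exc⟩ : State K) :=
          pwin_of_memRow4B f hrest hat β hβ s'.r s'.exc
        rw [← hF] at hw
        exact hw
      | some γ' =>
        exfalso
        have hz := coeff_zero_of_equimultiple f r exc (pwitB_low hat).1 (pwitB_low hat).2 heq
        rw [← hG, hbeq, translate_single_map_spec, tau_evalT, ← PointBlowup.translate_zero
          (spec f β (evalT (transVar i.castSucc ρ G)))] at hz
        exact coeff_ne_zero_of_pwitB f β hβ hat (b := 0) (fun _ _ => rfl) hz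
  | pair γ i i' ρ d sub =>
    simp only [pnode5B, Bool.and_eq_true, decide_eq_true_eq, Bool.or_eq_true] at h
    obtain ⟨⟨⟨⟨hU, htf⟩, hpair⟩, hsub⟩, hmem⟩ := h
    have htie := coord_eq_of_ppairB f β hβ hpair hb
      (coeff_zero_of_equimultiple f r exc (ppairB_low hpair).1 (ppairB_low hpair).2 heq)
    have hii' := ppairB_ne hpair
    subst hU
    by_cases hbi' : b i' = 0
    · have hlt : pheight sub < n := by
        rw [pheight] at ht; omega
      refine ih sub hlt _ hsub b (fun m hm => ?_) heq hne
      by_cases hmi : m = i'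
      · rw [hmi]; exact hbi'
      · exact hb m fun hmU => hm (Finset.mem_erase.mpr ⟨hmi, hmU⟩)
    · set s' := CentreBlowup.step q S j b (⟨spec f β (evalT L), r, exc⟩ : State K) with hs'
      have hbeq := eq_pairpt f hii' hb htie
      have htr : ∀ X : MvPolynomial (Fin 4) K, PointBlowup.translate b X =
          PointBlowup.translate (Pi.single i' (b i') + Pi.single i (f ρ * b i' ^ d)) X := fun X => by rw [← hbeq]
      have hpt : PointBlowup.translate b (spec f β (evalT G)) =
          spec f (b i') (evalT (shearMonoL i ρ d (shearL i' G))) := by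
        rw [spec_eq_of_tfree f htf β (b i'), htr, translate_pair_spec f (b i') hii', shearAlg_evalT,
          shearMonoAlg_evalT]
      rcases hmem with hmem | hdead
      · have hF : s'.F = spec f (b i') (evalT (clean4 q (shearMonoL i ρ d (shearL i' G)))) := by
          rw [hs', DivClock.step_F_eq, chartTransform_spec, ← hG, hpt, deletePthPowers_spec]
        have hw : RWins q localB
            (⟨spec f (b i') (evalT (clean4 q (shearMonoL i ρ d (shearL i' G)))), s'.r, s'.exc⟩ : State K) :=
          pwin_of_memRow4B f hrest hmem (b i') hbi' s'.r s'.exc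
        rw [← hF] at hw
        exact hw
      · exfalso
        obtain ⟨γ', -, hwit⟩ := hdead
        have hz := coeff_zero_of_equimultiple f r exc (pwitB_low hwit).1 (pwitB_low hwit).2 heq
        rw [← hG, hpt, ← PointBlowup.translate_zero (spec f (b i') (evalT (shearMonoL i ρ d (shearL i' G))))] at hz
        exact coeff_ne_zero_of_pwitB f (b i') hbi' hwit (b := 0) (fun _ _ => rfl) hz
  | rel γ γ' zs nu κ subs =>
    simp only [pnode5B, Bool.and_eq_true, decide_eq_true_eq] at h
    obtain ⟨⟨hrel, hcov⟩, hforest⟩ := h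
    obtain ⟨i, hi, hbi⟩ := exists_zero_of_prelB f β hβ hrel hb
      (coeff_zero_of_equimultiple f r exc (prelB_low hrel).1.1 (prelB_low hrel).1.2 heq)
      (coeff_zero_of_equimultiple f r exc (prelB_low hrel).2.1 (prelB_low hrel).2.2 heq)
    have hi' := hcov hi
    rw [List.mem_toFinset, List.mem_map] at hi'
    obtain ⟨⟨i₀, t'⟩, hmem, hi₀⟩ := hi'
    simp only at hi₀
    subst hi₀
    have hlt : pheight t' < n := by
      have h1 := pheight_le_of_mem subs i₀ t' hmem
      rw [pheight] at ht; omega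
    refine ih t' hlt _ (pnodeB_of_mem_forest subs U hforest i₀ t' hmem) b (fun m hm => ?_) heq hne
    by_cases hmi : m = i₀
    · rw [hmi]; exact hbi
    · exact hb m fun hmU => hm (Finset.mem_erase.mpr ⟨hmi, hmU⟩)
  | split γ subs =>
    simp only [pnode5B, Bool.and_eq_true] at h
    obtain ⟨hsplit, hforest⟩ := h
    obtain ⟨i, hi, hbi⟩ := exists_zero_of_psplitB f β hβ hsplit hb
      (coeff_zero_of_equimultiple f r exc (psplitB_low hsplit).1 (psplitB_low hsplit).2 heq)
    rw [List.mem_toFinset, List.mem_map] at hi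
    obtain ⟨⟨i₀, t'⟩, hmem, hi₀⟩ := hi
    simp only at hi₀
    subst hi₀
    have hlt : pheight t' < n := by
      have h1 := pheight_le_of_mem subs i₀ t' hmem
      rw [pheight] at ht; omega
    refine ih t' hlt _ (pnodeB_of_mem_forest subs U hforest i₀ t' hmem) b (fun m hm => ?_) heq hne
    by_cases hmi : m = i₀
    · rw [hmi]; exact hbi
    · exact hb m fun hmU => hm (Finset.mem_erase.mpr ⟨hmi, hmU⟩)

/-- **soundness of a chart tree.** OURS. [folklore] -/
theorem pnode_sound
    (hrest : ∀ row ∈ rest, (∀ β : K, β ≠ 0 → ∀ (r : Fin 4 →₀ ℕ) (exc : Finset (Fin 4)),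
      RWins q localB (⟨spec f β (evalT row.1), r, exc⟩ : State K))) (hβ : β ≠ 0) (t : PNode k)
    (U : Finset (Fin 4)) (h : pnode5B q rest (chartL q (S5 S) j.castSucc L) U t = true) (b : Fin 4 → K)
    (hb : ∀ m : Fin 4, m ∉ U → b m = 0) (heq : IsEquimultiplePoint q S j b (⟨spec f β (evalT L), r, exc⟩ : State K))
    (hne : (CentreBlowup.step q S j b (⟨spec f β (evalT L), r, exc⟩ : State K)).F ≠ 0) :
    RWins q localB (CentreBlowup.step q S j b (⟨spec f β (evalT L), r, exc⟩ : State K)) :=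
  pnode_sound_aux f r exc hrest hβ (pheight t + 1) t (Nat.lt_succ_self _) U h b hb heq hne

end Tree

/-! ## §3 Rows, tables, entry point -/

/-- **soundness of one v4 row.** OURS. [folklore] -/
theorem pwin_of_prow5B {q : ℕ} (hq : 2 ≤ q) {rest : List (PRow4 k)}
    (hrest : ∀ row ∈ rest, (∀ β : K, β ≠ 0 → ∀ (r : Fin 4 →₀ ℕ) (exc : Finset (Fin 4)),
      RWins q localB (⟨spec f β (evalT row.1), r, exc⟩ : State K))) {row : PRow4 k}
    (h : prow5B q rest row = true) :
    (∀ β : K, β ≠ 0 → ∀ (r : Fin 4 →₀ ℕ) (exc : Finset (Fin 4)),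
      RWins q localB (⟨spec f β (evalT row.1), r, exc⟩ : State K)) := by
  obtain ⟨L, cert⟩ := row
  intro β hβ r exc
  cases cert with
  | blind c w α₀ a =>
    simp only [prow5B, Bool.and_eq_true] at h
    obtain ⟨htf, hblind⟩ := h
    refine Game.Wins.terminal fun _ hS => ?_
    have hns := WinCertAllFields.not_inCoordinateScope_map_of_blindB f hblind
    rw [← spec_eq_map_trunc f β htf] at hns
    exact hns hS.1
  | coat m e₀ ex =>
    simp only [prow5B] at h
    exact Game.Wins.terminal fun _ hS => not_inCoordinateScope_of_pcoatB f hq h β hS.1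
  | move S ch =>
    simp only [prow5B, Bool.and_eq_true, decide_eq_true_eq] at h
    obtain ⟨hperm, hall⟩ := h
    by_cases hsc : InCoordinateScope q (spec f β (evalT L))
    · refine Game.Wins.move (m := S) ⟨hsc, isPermissibleCentre_spec f β hperm⟩ ?_
      rintro s' ⟨j, b, hj, hbj, hloc, heq, hne, rfl⟩
      exact pnode_sound f r exc hrest hβ (ch j) (S.erase j) (hall j hj) b
        (vanish_erase K hbj ((localB_eq_true_iff S j b).mp hloc)) heq hne
    · exact Game.Wins.terminal fun _ hS' => hsc hS'.1

/-- **SOUNDNESS OF v4 CERTIFICATES**: every row of a checked table is certified. OURS. [folklore] -/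
theorem pwin_of_pcert5B {q : ℕ} (hq : 2 ≤ q) : ∀ {T : List (PRow4 k)}, pcert5B q T = true → ∀ row ∈ T,
    (∀ β : K, β ≠ 0 → ∀ (r : Fin 4 →₀ ℕ) (exc : Finset (Fin 4)),
      RWins q localB (⟨spec f β (evalT row.1), r, exc⟩ : State K))
  | [], _ => fun row hrow => absurd hrow List.not_mem_nil
  | row :: rest, h => by
    unfold pcert5B at h
    rw [Bool.and_eq_true] at h
    have hrest := pwin_of_pcert5B hq h.2
    intro r hr
    rcases List.mem_cons.mp hr with rfl | hr'
    · exact pwin_of_prow5B f hq hrest h.1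
    · exact hrest r hr'

/-- **an `𝔽₃` state whose embedding heads a checked v4 table is a LOCAL A-win over EVERY field of characteristic 3.**
OURS. [folklore] -/
theorem rWins_liftState_of_pcert5B (L : Type) [Field L] [CharP L 3] [DecidableEq L] {s : SData 4 (ZMod 3)}
    {cert : PRowCert4 (ZMod 3)} {rest : List (PRow4 (ZMod 3))} (h : pcert5B 3 ((embed s.L, cert) :: rest) = true) :
    RWins 3 localB (liftState L s.toState) := by
  have hw := pwin_of_pcert5B (φ3 L) (by norm_num) h (embed s.L, cert) List.mem_cons_self 1 one_ne_zero (expo s.r) s.exc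
  rw [spec_embed] at hw
  exact hw

end LoopCLocal

end Summit.ResolutionOfSingularities.ResolutionOfSingularities.Theorems.PIDim4

end
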